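/-
Copyright (c) 2026 the pub-hodgecm-mathlib formalisation cell (harness21).  Prover seat hodgecm-mathlib-R90-CS-p03 (g2), R90-TF section S8 «ContSpec-n½» (dealer R90-CS-plan (g2),
deal S8-R85 ∕ S8-R105, census `R90/S8/CENSUS-ChiLocalMeansOfShell.R90-CS-p03-g0.md`): the good-place `χ`-LOCAL MEANS of the `U(2,1)_{L∕L⁺}` intertwining integrand FROM THE
TORUS-ENTRY LETTERS — the token letters `hin ∕ hsp` of ★ (a-1) `K2E1ChiIntertwiningScalarEulerProductU3Finite` discharged down to (W)'s shell data.
-/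
import Summits.HodgeConjecture.HodgeConjecture.Theorems.K2E1ChiIntertwiningLocalScalarU3        -- ★ B1-local `chiLocalMean_eq_token_of_shell_nonsplit`; brings ★ `K2E1IntertwiningLocalMeanCMU3` (`pi_integralBox_toReal`), ★ `…LocalHeightU3`
import Summits.HodgeConjecture.HodgeConjecture.Theorems.K2E1ChiIntertwiningLocalScalarSplitU3   -- ★ split sequel `chiLocalIntegral_eq_token_of_shell_split` (K2E1-p13)
import Summits.HodgeConjecture.HodgeConjecture.Theorems.K2E1ChiLocalWeightShellU3               -- ★ (W) `shell_nonsplit_of_torusEntry`, `shell_split_of_torusEntries` (R90-C10-p07)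
import Literature.NumberTheory.GaloisRepresentations.CMTypeHeckeCharacter                     -- ★ `HeckeCharacter.isUnramifiedAt_iff_forall_valued_eq_one`
import Literature.NumberTheory.GaloisRepresentations.HeckeCharacterProofs                      -- ★ `HeckeCharacter.norm_valueAtUniformizer_of_isUnitary`
import Literature.NumberTheory.Automorphic.AddCharConductorExponent                            -- ★ `normAbs_eq_inv_of_valued_eq_exp_neg_one`, `normAbs_le_normAbs_iff_valued`
import Literature.NumberTheory.Automorphic.AdicCompletionResidueCard                           -- ★ `residueFieldCard_adicCompletion_eq` (`q_{K_v} = q_v`)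
import HarnessLib

/-!
# K2·E1 ∕ R90·S8 — `K2E1ChiLocalMeansOfShellU3`: THE GOOD-PLACE `χ`-LOCAL MEANS OF THE `U(2,1)` INTERTWINING INTEGRAND FROM THE TORUS-ENTRY LETTERS —
# ★ (a-1)'s token letters `hin` (inert) ∕ `hsp` (split) discharged to (W)'s shell data `α, hα, hω1, hωQ` (inert) ∕ `α₁ α₂ c₁ c₂ …` (split)

Cell `pub/hodgecm-mathlib`, crux h413 = `stmt-HodgeConjecture-24833`, route of record `HCCMUnconditional`; R90-TF section S8 «ContSpec-n½», road R2-χ₃ (the (V) scalar road: file B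
`sock_S8_res_piN_occurs` #3 ∕ #2♯).  THEOREMS ONLY (no `def`, no `instance`, no notation, no named-fact hypothesis, no `sorry`; default heartbeats); lane
`--supports stmt-HodgeConjecture-24833 --as helper` (count-neutral).  Closes no socket.

THE MATHEMATICS ([Rogawski1990] §13.9 p. 229 `M(s) = L(s,φ)L(2s,φ′ω)∕(L(s+1,φ)L(2s+1,φ′ω))`, §4.5; [Langlands1971] §3; [Casselman1980] §3; [TateThesis1967] §2.5).  At a good
finite place `v ∉ S₀` of `L⁺` the `χ`-weighted local mean `m_v(z) = ν(𝒪_v³)⁻¹·∫ ω_v·Q_v^{−z}` of the big-cell intertwining integrand is the unramified local factor of Rogawski's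
quotient: ★ B1-local `K2E1ChiIntertwiningLocalScalarU3.chiLocalMean_eq_token_of_shell_nonsplit` (inert `w ∣ v`, token in `e = φ_w(ϖ_w)`) and ★ `K2E1ChiIntertwiningLocalScalarSplitU3.
chiLocalIntegral_eq_token_of_shell_split` (split `v = w·w̄`, two-exponent Gindikin–Karpelevich cell, token in `u₁, u₂`) compute it from a SHELL LETTER («on the shell `{Q_v = q^k}` the
weight is `e^k`»), and ★ (W) `K2E1ChiLocalWeightShellU3` derives the shell letter from the TORUS-ENTRY LETTERS of the Iwasawa decomposition `ι(w₀)·u(X,Z) = u′·m·k` ((α) a torus-entry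
function `α` with `‖α(p)‖·Q_v(p) = 1` off the unit shell; (c) the weight is `1` on `{Q_v = 1}` and `χ(α(p))` on `{Q_v > 1}`, `χ` unramified).  THIS FILE composes the two and supplies
the dictionary an actual Hecke character `φ` of `L` needs: `χ_w := φ.localComponent w` is trivial on norm-one units when `φ.IsUnramifiedAt w` (★ `isUnramifiedAt_iff_forall_valued_eq_one`
+ `‖·‖ ↔ |·|_v`), `‖ϖ_w‖ = q_w⁻¹` for the tree's uniformizer (★ `normAbs_eq_inv_of_valued_eq_exp_neg_one` ∘ ★ `HeckeCharacter.valued_uniformizer`), `(χ_w ϖ_w : ℂ) = φ.valueAtUniformizer w`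
(`rfl`), `‖φ.valueAtUniformizer w‖ = 1` for unitary `φ` (★), and at a split place the transport `ι_w : L⁺_v →+* L_w` (★ `toPlace`, `|ι_w y|_w = |y|_v` ★ `valued_toPlace_of_split`).  Results:
* §0 dictionary: `valued_eq_one_of_normAbs_eq_one`, `normAbs_eq_one_of_valued_eq_one`, `localComponent_eq_one_of_normAbs_eq_one`, `normAbs_heckeUniformizer`,
  `localComponent_toPlace_eq_one_of_normAbs_eq_one`, `localComponent_toPlace_heckeUniformizer` (split transport).
* §1 INERT: **`chiLocalMean_eq_inertToken_of_torusEntry'`** (generic unramified `χ_w`, uniformizer `π_w`, `(χ_w π_w : ℂ) = e`, `‖e‖ = 1`) and **`chiLocalMean_eq_inertToken_of_torusEntry`**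
  (`χ_w := φ.localComponent w`, `e = φ.valueAtUniformizer w`): `ν(𝒪_v³)⁻¹ • ∫ ω·Q_v^{−z} = (1 − e q_v^{−2z})(1 + e q_v^{−(2z−1)}) ∕ ((1 − e q_v^{−(2z−2)})(1 + e q_v^{−(2z−2)}))` (`1 < Re z`) —
  EXACTLY the body of (a-1)'s `hin` at the place `v` (real `•`, `v.residueCard`).
* §2 SPLIT: **`chiLocalMean_eq_splitToken_of_torusEntries`** — from (W) §3's letters over `L⁺_v` in Gindikin–Karpelevich base coordinates (`δ₁ = δ_w =` ★ `splitSqrt`), generic unramified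
  `χ₁ χ₂`, uniformizer `π`, identifications `(χ_j π : ℂ) = e_j`, `‖e_j‖ = 1`: `ν(𝒪_v³)⁻¹ • ∫ ω·Q_v^{−z} =` (a-1)'s split token in `(e₁, e₂)` — the bridge `Q_v = A(Φ·)·B(Φ·)`
  (★ `prod_placesOver_max_one_norm_height_eq_gl3_of_split`), `(ν⊗ν⊗ν)(𝒪_v³) = ν(𝒪_v)³` (★ `pi_integralBox_toReal`), `q_{L⁺_v} = q_v` (★); `splitToken_symm` (the token is symmetric in `e₁ ↔ e₂`).
* PACKAGING in (a-1)'s binder shapes (`∀ v ∉ S₀, ∀ w, c • w = w → m_v(z) = inertToken(φ.valueAtUniformizer w)` from per-place `∃ α, …`; `… ≠ … → splitToken(φ(ϖ_w), φ(ϖ_{w̄}))`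
  from per-place `∃ χ₁ χ₂ π α₁ α₂ c₁ c₂, …`) rides in the companion file `K2E1ChiLocalMeansOfShellU3Letters` (line budget); with it (a-1)'s HEAD
  `inv_measure_smul_integral_finprod_chi_eq_prod_mul_chiScalar_three` is callable from the torus-entry letters alone.
HONEST SCOPE.  NOT here: the torus-entry letters themselves (the explicit Iwasawa factorisation of `ι(w₀)·u(X,Z)`: inert `α = Z̄_w⁻¹` — R90-C10-p07's `K2E1BigCellIwasawaTorusEntryU3`;
split: the `GL₃` minors), nor the identification of the split root characters with `φ_w, φ_w̄` (left as the letters `he₁ he₂`; §0 discharges them for the plain transports `φ_{w'} ∘ ι_{w'}`).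
HONEST LABEL: HC_CM is proved only modulo the 7 printed citations (2 remaining named inputs: hLiu418 = `stmt-HodgeConjecture-24832`, h413 = `stmt-HodgeConjecture-24833`) until rung 0
closes; REL ≠ ★ ≠ BUILT; this file asserts no named fact and closes no socket; count-neutral; unconditional local algebra.

## References
* [Rogawski1990] J. D. Rogawski, *Automorphic Representations of Unitary Groups in Three Variables*, Ann. of Math. Stud. 123 (1990): §4.5 p. 45, §13.9 p. 229.
* [Langlands1971] R. P. Langlands, *Euler Products* (1971): §3.
* [Casselman1980] W. Casselman, *The unramified principal series of p-adic groups I*, Compositio Math. 40 (1980): §3.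
* [TateThesis1967] J. Tate, *Fourier analysis in number fields and Hecke's zeta-functions* (1967): §2.3, §2.5.
* [CasselsFrohlichANT1967] J. W. S. Cassels, A. Fröhlich (eds.), *Algebraic Number Theory* (1967): Ch. II §7, §10.
-/

set_option autoImplicit false
set_option linter.dupNamespace false -- the mandated namespace repeats `HodgeConjecture.HodgeConjecture`

noncomputable section

open MeasureTheory NumberField IsDedekindDomain Filter
open scoped NNReal ENNReal
open Literature.NumberTheory.Automorphic Literature.NumberTheory.Automorphic.UnitaryGroup Literature.NumberTheory.GaloisRepresentations
open Literature.NumberTheory.GaloisRepresentations.IsNonarchimedeanLocalField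
open Literature.NumberTheory.GelbartRogawski1991.UnitaryDualPair.LocalSplitting (splitSqrt valued_toPlace_of_split toPlace_splitSqrt)
open Summit.HodgeConjecture.HodgeConjecture.Cruxes.H413.K2E1IntertwiningLocalMeanCMU3 (pi_integralBox_toReal)
open Summit.HodgeConjecture.HodgeConjecture.Cruxes.H413.K2E1IntertwiningLocalFactorU3HeightSplit (prod_placesOver_max_one_norm_height_eq_gl3_of_split)
open Summit.HodgeConjecture.HodgeConjecture.Cruxes.H413.K2E1ChiIntertwiningLocalScalarU3 (chiLocalMean_eq_token_of_shell_nonsplit)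
open Summit.HodgeConjecture.HodgeConjecture.Cruxes.H413.K2E1ChiIntertwiningLocalScalarSplitU3 (chiLocalIntegral_eq_token_of_shell_split)
open Summit.HodgeConjecture.HodgeConjecture.Cruxes.H413.K2E1ChiLocalWeightShellU3 (shell_nonsplit_of_torusEntry shell_split_of_torusEntries)

namespace Summit.HodgeConjecture.HodgeConjecture.Cruxes.H413.K2E1ChiLocalMeansOfShellU3

/-! ## §0 Dictionary: `‖·‖ ↔ |·|_v` on `K_v`, unramified local components, the tree's uniformizer, split transport -/

section Dictionary

variable {K : Type} [Field K] [NumberField K] (v : HeightOneSpectrum (𝓞 K))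

/-- On `K_v`: `‖u‖ = 1 ⟹ |u|_v = 1` (★ `normAbs_le_normAbs_iff_valued` against `1`). [cite: CasselsFrohlichANT1967, Ch. II §7] -/
theorem valued_eq_one_of_normAbs_eq_one {u : v.adicCompletion K} (hu : normAbs (v.adicCompletion K) u = 1) : Valued.v u = 1 := by
  have h1 : normAbs (v.adicCompletion K) u ≤ normAbs (v.adicCompletion K) 1 := by rw [hu, map_one]
  have h2 : normAbs (v.adicCompletion K) 1 ≤ normAbs (v.adicCompletion K) u := by rw [hu, map_one]
  rw [normAbs_le_normAbs_iff_valued, map_one] at h1 h2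
  exact le_antisymm h1 h2

/-- On `K_v`: `|u|_v = 1 ⟹ ‖u‖ = 1`. [cite: CasselsFrohlichANT1967, Ch. II §7] -/
theorem normAbs_eq_one_of_valued_eq_one {u : v.adicCompletion K} (hu : Valued.v u = 1) : normAbs (v.adicCompletion K) u = 1 := by
  refine le_antisymm ?_ ?_
  · rw [← map_one (normAbs (v.adicCompletion K)), normAbs_le_normAbs_iff_valued, hu, map_one]
  · rw [← map_one (normAbs (v.adicCompletion K)), normAbs_le_normAbs_iff_valued, hu, map_one]

/-- **An unramified local component kills the norm-one units**: `φ.IsUnramifiedAt v`, `‖u‖ = 1 ⟹ φ_v(u) = 1` (★ `isUnramifiedAt_iff_forall_valued_eq_one`; `φ_v = φ ∘ localUnits v`, `rfl`).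
This is (W)'s letter `hχ` for `χ_w := φ.localComponent w`. [cite: TateThesis1967, §2.3] -/
theorem localComponent_eq_one_of_normAbs_eq_one {χ : HeckeCharacter K} (hχ : χ.IsUnramifiedAt v) (u : (v.adicCompletion K)ˣ)
    (hu : normAbs (v.adicCompletion K) (u : v.adicCompletion K) = 1) : χ.localComponent v u = 1 :=
  HeckeCharacter.isUnramifiedAt_iff_forall_valued_eq_one.1 hχ u (valued_eq_one_of_normAbs_eq_one v hu)

variable (K) in
/-- **`‖ϖ_v‖ = q_v⁻¹` for the tree's chosen uniformizer `HeckeCharacter.uniformizer K v`** (`|ϖ_v|_v = exp (−1)` ★ `valued_uniformizer`, ★ `normAbs_eq_inv_of_valued_eq_exp_neg_one`) — (W)'s letter `hπ`.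
[cite: CasselsFrohlichANT1967, Ch. II §7] -/
theorem normAbs_heckeUniformizer :
    normAbs (v.adicCompletion K) (HeckeCharacter.uniformizer K v : v.adicCompletion K) = (residueFieldCard (v.adicCompletion K) : ℝ≥0)⁻¹ :=
  normAbs_eq_inv_of_valued_eq_exp_neg_one v (HeckeCharacter.valued_uniformizer (K := K) v)

end Dictionary

section SplitTransport

variable (L : Type) [Field L] [NumberField L] [IsCMField L] (v : HeightOneSpectrum (𝓞 ↥(maximalRealSubfield L)))

/-- **The transported local component at a split place is unramified in (W)'s sense**: for `w' ∣ v` split (`c • w' ≠ w'`) and `φ.IsUnramifiedAt w'`, the character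
`φ_{w'} ∘ ι_{w'} : (L⁺_v)^× → ℂ^×` kills `{‖u‖_v = 1}` (`|ι_{w'} u|_{w'} = |u|_v` ★ `valued_toPlace_of_split`). [cite: CasselsFrohlichANT1967, Ch. II §10] [cite: TateThesis1967, §2.3] -/
theorem localComponent_toPlace_eq_one_of_normAbs_eq_one (w' : PlacesOver L v) (hw' : IsCMField.complexConj L • w'.1 ≠ w'.1) {φ : HeckeCharacter L} (hφw : φ.IsUnramifiedAt w'.1)
    (u : (v.adicCompletion ↥(maximalRealSubfield L))ˣ) (hu : normAbs (v.adicCompletion ↥(maximalRealSubfield L)) (u : v.adicCompletion ↥(maximalRealSubfield L)) = 1) :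
    (φ.localComponent w'.1).comp (Units.map (toPlace v w' : v.adicCompletion ↥(maximalRealSubfield L) →+* w'.1.adicCompletion L).toMonoidHom) u = 1 := by
  haveI : Algebra.IsQuadraticExtension ↥(maximalRealSubfield L) L := IsCMField.isQuadraticExtension L
  refine HeckeCharacter.isUnramifiedAt_iff_forall_valued_eq_one.1 hφw _ ?_
  show Valued.v (toPlace v w' (u : v.adicCompletion ↥(maximalRealSubfield L))) = 1
  rw [valued_toPlace_of_split ↥(maximalRealSubfield L) L (IsCMField.complexConj L) v w' hw', valued_eq_one_of_normAbs_eq_one v hu]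

/-- **The transported local component at the transported uniformizer is `φ.valueAtUniformizer`**: at a split `w' ∣ v` with `φ.IsUnramifiedAt w'`, `φ_{w'}(ι_{w'} ϖ_v) = φ(ϖ_{w'})`
(`|ι_{w'} ϖ_v|_{w'} = exp (−1)` ★ `valued_toPlace_of_split` + ★ `valued_uniformizer`; independence of the uniformizer ★ `localComponent_eq_valueAtUniformizer`). [cite: TateThesis1967, §2.5] -/
theorem localComponent_toPlace_heckeUniformizer (w' : PlacesOver L v) (hw' : IsCMField.complexConj L • w'.1 ≠ w'.1) {φ : HeckeCharacter L} (hφw : φ.IsUnramifiedAt w'.1) :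
    (((φ.localComponent w'.1).comp (Units.map (toPlace v w' : v.adicCompletion ↥(maximalRealSubfield L) →+* w'.1.adicCompletion L).toMonoidHom)
        (HeckeCharacter.uniformizer ↥(maximalRealSubfield L) v) : ℂˣ) : ℂ) = φ.valueAtUniformizer w'.1 := by
  haveI : Algebra.IsQuadraticExtension ↥(maximalRealSubfield L) L := IsCMField.isQuadraticExtension L
  refine HeckeCharacter.localComponent_eq_valueAtUniformizer hφw ?_
  show Valued.v (toPlace v w' (HeckeCharacter.uniformizer ↥(maximalRealSubfield L) v : v.adicCompletion ↥(maximalRealSubfield L))) = WithZero.exp (-1 : ℤ)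
  rw [valued_toPlace_of_split ↥(maximalRealSubfield L) L (IsCMField.complexConj L) v w' hw', HeckeCharacter.valued_uniformizer]

end SplitTransport

variable (L : Type) [Field L] [NumberField L] [IsCMField L] {δ : L} (hcδ : IsCMField.complexConj L δ = -δ) (hδ : δ ≠ 0)
  {d : ↥(maximalRealSubfield L)} (hd : δ * δ = algebraMap ↥(maximalRealSubfield L) L d)
  (v : HeightOneSpectrum (𝓞 ↥(maximalRealSubfield L)))
  [MeasurableSpace (v.adicCompletion ↥(maximalRealSubfield L))] [BorelSpace (v.adicCompletion ↥(maximalRealSubfield L))]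
  (ν : Measure (v.adicCompletion ↥(maximalRealSubfield L))) [ν.IsAddHaarMeasure]

/-! ## §1 INERT: the `χ`-local mean from the torus-entry letters (★ B1-local ∘ ★ (W) §2) -/

include hd in
/-- **THE INERT `χ`-LOCAL MEAN FROM THE TORUS-ENTRY LETTERS, GENERIC CHARACTER.**  `v` unramified in `L` with `|2|_v = 1`, `w ∣ v` NON-SPLIT with `δ_w` a unit, Haar `ν` on `L⁺_v`;
an unramified character `χ_w` of `L_w^×` (trivial on `{‖u‖ = 1}`), a uniformizer `π_w` (`‖π_w‖ = q_w⁻¹`) with `(χ_w π_w : ℂ) = e`, `‖e‖ = 1`; the torus-entry letter (α) `‖α(p)‖_w·Q_v(p) = 1` on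
`{Q_v > 1}` and the weight letters (c) `ω = 1` on `{Q_v = 1}`, `ω = χ_w(α(·))` on `{Q_v > 1}`.  THEN for `1 < Re z`, in the normalised-mean currency of ★ (a-1) (real `•`):
`ν(𝒪_v³)⁻¹ • ∫ ω·Q_v^{−z} dν³ = (1 − e·q_v^{−2z})(1 + e·q_v^{−(2z−1)}) ∕ ((1 − e·q_v^{−(2z−2)})(1 + e·q_v^{−(2z−2)}))` — ★ (W) `shell_nonsplit_of_torusEntry` feeds ★ B1-local
`chiLocalMean_eq_token_of_shell_nonsplit` (`Complex.real_smul` bridges `•` to B1-local's `ofReal`-product). [cite: Rogawski1990, §13.9 p. 229] [cite: Casselman1980, §3] [cite: Langlands1971, §3] -/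
theorem chiLocalMean_eq_inertToken_of_torusEntry' (hunr : Algebra.IsUnramifiedIn (𝓞 L) v.asIdeal) (w : PlacesOver L v) (hw : IsCMField.complexConj L • w.1 = w.1)
    (h2 : Valued.v (2 : v.adicCompletion ↥(maximalRealSubfield L)) = 1) (hδu : Valued.v (algebraMap L (LocalRing L v) δ w) = 1)
    (χw : (w.1.adicCompletion L)ˣ →* ℂˣ) (hχ : ∀ u : (w.1.adicCompletion L)ˣ, normAbs (w.1.adicCompletion L) (u : w.1.adicCompletion L) = 1 → χw u = 1)
    (πw : (w.1.adicCompletion L)ˣ) (hπ : normAbs (w.1.adicCompletion L) (πw : w.1.adicCompletion L) = (residueFieldCard (w.1.adicCompletion L) : ℝ≥0)⁻¹)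
    {e : ℂ} (he : ((χw πw : ℂˣ) : ℂ) = e) (hu : ‖e‖ = 1)
    (α : (Fin 3 → v.adicCompletion ↥(maximalRealSubfield L)) → (w.1.adicCompletion L)ˣ)
    (hα : ∀ p : Fin 3 → v.adicCompletion ↥(maximalRealSubfield L),
      1 < (∏ w' : PlacesOver L v, max 1 (max ((normAbs (w'.1.adicCompletion L) (quadraticLocalEquiv L v (IsCMField.complexConj L) hcδ hδ (p 0, p 1) w') : ℝ≥0) : ℝ)
          ((normAbs (w'.1.adicCompletion L) ((toLocalRing L v (p 2) * algebraMap L (LocalRing L v) δ -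
            toLocalRing L v 2⁻¹ * (quadraticLocalEquiv L v (IsCMField.complexConj L) hcδ hδ (p 0, p 1) *
              conjLocal L (IsCMField.complexConj L) v (quadraticLocalEquiv L v (IsCMField.complexConj L) hcδ hδ (p 0, p 1)))) w') : ℝ≥0) : ℝ))) →
      ((normAbs (w.1.adicCompletion L) (α p : w.1.adicCompletion L) : ℝ≥0) : ℝ) *
        (∏ w' : PlacesOver L v, max 1 (max ((normAbs (w'.1.adicCompletion L) (quadraticLocalEquiv L v (IsCMField.complexConj L) hcδ hδ (p 0, p 1) w') : ℝ≥0) : ℝ)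
          ((normAbs (w'.1.adicCompletion L) ((toLocalRing L v (p 2) * algebraMap L (LocalRing L v) δ -
            toLocalRing L v 2⁻¹ * (quadraticLocalEquiv L v (IsCMField.complexConj L) hcδ hδ (p 0, p 1) *
              conjLocal L (IsCMField.complexConj L) v (quadraticLocalEquiv L v (IsCMField.complexConj L) hcδ hδ (p 0, p 1)))) w') : ℝ≥0) : ℝ))) = 1)
    (ω : (Fin 3 → v.adicCompletion ↥(maximalRealSubfield L)) → ℂ)
    (hω1 : ∀ p : Fin 3 → v.adicCompletion ↥(maximalRealSubfield L),
      (∏ w' : PlacesOver L v, max 1 (max ((normAbs (w'.1.adicCompletion L) (quadraticLocalEquiv L v (IsCMField.complexConj L) hcδ hδ (p 0, p 1) w') : ℝ≥0) : ℝ)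
          ((normAbs (w'.1.adicCompletion L) ((toLocalRing L v (p 2) * algebraMap L (LocalRing L v) δ -
            toLocalRing L v 2⁻¹ * (quadraticLocalEquiv L v (IsCMField.complexConj L) hcδ hδ (p 0, p 1) *
              conjLocal L (IsCMField.complexConj L) v (quadraticLocalEquiv L v (IsCMField.complexConj L) hcδ hδ (p 0, p 1)))) w') : ℝ≥0) : ℝ))) = 1 → ω p = 1)
    (hωQ : ∀ p : Fin 3 → v.adicCompletion ↥(maximalRealSubfield L),
      1 < (∏ w' : PlacesOver L v, max 1 (max ((normAbs (w'.1.adicCompletion L) (quadraticLocalEquiv L v (IsCMField.complexConj L) hcδ hδ (p 0, p 1) w') : ℝ≥0) : ℝ)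
          ((normAbs (w'.1.adicCompletion L) ((toLocalRing L v (p 2) * algebraMap L (LocalRing L v) δ -
            toLocalRing L v 2⁻¹ * (quadraticLocalEquiv L v (IsCMField.complexConj L) hcδ hδ (p 0, p 1) *
              conjLocal L (IsCMField.complexConj L) v (quadraticLocalEquiv L v (IsCMField.complexConj L) hcδ hδ (p 0, p 1)))) w') : ℝ≥0) : ℝ))) →
      ω p = ((χw (α p) : ℂˣ) : ℂ))
    {z : ℂ} (hz : 1 < z.re) :
    ((Measure.pi fun _ : Fin 3 => ν) (integralBox ↥(maximalRealSubfield L) (Fin 3) v)).toReal⁻¹ •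
        ∫ p : Fin 3 → v.adicCompletion ↥(maximalRealSubfield L),
          ω p * (((∏ w' : PlacesOver L v, max 1 (max ((normAbs (w'.1.adicCompletion L) (quadraticLocalEquiv L v (IsCMField.complexConj L) hcδ hδ (p 0, p 1) w') : ℝ≥0) : ℝ)
            ((normAbs (w'.1.adicCompletion L) ((toLocalRing L v (p 2) * algebraMap L (LocalRing L v) δ -
              toLocalRing L v 2⁻¹ * (quadraticLocalEquiv L v (IsCMField.complexConj L) hcδ hδ (p 0, p 1) *
                conjLocal L (IsCMField.complexConj L) v (quadraticLocalEquiv L v (IsCMField.complexConj L) hcδ hδ (p 0, p 1)))) w') : ℝ≥0) : ℝ))) : ℝ) : ℂ) ^ (-z)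
          ∂(Measure.pi fun _ : Fin 3 => ν) =
      (1 - e * (v.residueCard : ℂ) ^ (-(2 * z))) * (1 + e * (v.residueCard : ℂ) ^ (-(2 * z - 1))) /
        ((1 - e * (v.residueCard : ℂ) ^ (-(2 * z - 2))) * (1 + e * (v.residueCard : ℂ) ^ (-(2 * z - 2)))) := by
  have hshell := shell_nonsplit_of_torusEntry L hcδ hδ v hunr w hw χw hχ πw hπ α hα ω hω1 hωQ
  rw [he] at hshell
  rw [Complex.real_smul]
  exact chiLocalMean_eq_token_of_shell_nonsplit L hcδ hδ hd v ν hunr w hw h2 hδu hu ω hshell hz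

include hd in
/-- **THE INERT `χ`-LOCAL MEAN OF AN UNRAMIFIED UNITARY HECKE CHARACTER FROM THE TORUS-ENTRY LETTERS** — the body of ★ (a-1)'s letter `hin` at the place `v`, token for token.
`φ` a unitary Hecke character of `L` unramified at the non-split `w ∣ v` (`v` unramified in `L`, `|2|_v = 1`, `δ_w` a unit); `χ_w := φ.localComponent w`, the torus-entry letter (α)
`‖α(p)‖_w·Q_v(p) = 1` on `{Q_v > 1}` and the weight letters (c) `ω = 1` on `{Q_v = 1}`, `ω(p) = φ_w(α(p))` on `{Q_v > 1}`.  THEN for `1 < Re z`: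
`ν(𝒪_v³)⁻¹ • ∫ ω·Q_v^{−z} dν³ = (1 − e·q_v^{−2z})(1 + e·q_v^{−(2z−1)}) ∕ ((1 − e·q_v^{−(2z−2)})(1 + e·q_v^{−(2z−2)}))`, `e = φ.valueAtUniformizer w` (§0 dictionary: `hχ` from
`φ.IsUnramifiedAt w`, `hπ` = `‖ϖ_w‖ = q_w⁻¹`, `‖e‖ = 1` from unitarity, `(φ_w ϖ_w : ℂ) = φ.valueAtUniformizer w` by `rfl`). [cite: Rogawski1990, §13.9 p. 229] [cite: Casselman1980, §3]
[cite: TateThesis1967, §2.5] -/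
theorem chiLocalMean_eq_inertToken_of_torusEntry (hunr : Algebra.IsUnramifiedIn (𝓞 L) v.asIdeal) (w : PlacesOver L v) (hw : IsCMField.complexConj L • w.1 = w.1)
    (h2 : Valued.v (2 : v.adicCompletion ↥(maximalRealSubfield L)) = 1) (hδu : Valued.v (algebraMap L (LocalRing L v) δ w) = 1)
    {φ : HeckeCharacter L} (hφ : φ.IsUnitary) (hφw : φ.IsUnramifiedAt w.1)
    (α : (Fin 3 → v.adicCompletion ↥(maximalRealSubfield L)) → (w.1.adicCompletion L)ˣ)
    (hα : ∀ p : Fin 3 → v.adicCompletion ↥(maximalRealSubfield L),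
      1 < (∏ w' : PlacesOver L v, max 1 (max ((normAbs (w'.1.adicCompletion L) (quadraticLocalEquiv L v (IsCMField.complexConj L) hcδ hδ (p 0, p 1) w') : ℝ≥0) : ℝ)
          ((normAbs (w'.1.adicCompletion L) ((toLocalRing L v (p 2) * algebraMap L (LocalRing L v) δ -
            toLocalRing L v 2⁻¹ * (quadraticLocalEquiv L v (IsCMField.complexConj L) hcδ hδ (p 0, p 1) *
              conjLocal L (IsCMField.complexConj L) v (quadraticLocalEquiv L v (IsCMField.complexConj L) hcδ hδ (p 0, p 1)))) w') : ℝ≥0) : ℝ))) →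
      ((normAbs (w.1.adicCompletion L) (α p : w.1.adicCompletion L) : ℝ≥0) : ℝ) *
        (∏ w' : PlacesOver L v, max 1 (max ((normAbs (w'.1.adicCompletion L) (quadraticLocalEquiv L v (IsCMField.complexConj L) hcδ hδ (p 0, p 1) w') : ℝ≥0) : ℝ)
          ((normAbs (w'.1.adicCompletion L) ((toLocalRing L v (p 2) * algebraMap L (LocalRing L v) δ -
            toLocalRing L v 2⁻¹ * (quadraticLocalEquiv L v (IsCMField.complexConj L) hcδ hδ (p 0, p 1) *
              conjLocal L (IsCMField.complexConj L) v (quadraticLocalEquiv L v (IsCMField.complexConj L) hcδ hδ (p 0, p 1)))) w') : ℝ≥0) : ℝ))) = 1)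
    (ω : (Fin 3 → v.adicCompletion ↥(maximalRealSubfield L)) → ℂ)
    (hω1 : ∀ p : Fin 3 → v.adicCompletion ↥(maximalRealSubfield L),
      (∏ w' : PlacesOver L v, max 1 (max ((normAbs (w'.1.adicCompletion L) (quadraticLocalEquiv L v (IsCMField.complexConj L) hcδ hδ (p 0, p 1) w') : ℝ≥0) : ℝ)
          ((normAbs (w'.1.adicCompletion L) ((toLocalRing L v (p 2) * algebraMap L (LocalRing L v) δ -
            toLocalRing L v 2⁻¹ * (quadraticLocalEquiv L v (IsCMField.complexConj L) hcδ hδ (p 0, p 1) *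
              conjLocal L (IsCMField.complexConj L) v (quadraticLocalEquiv L v (IsCMField.complexConj L) hcδ hδ (p 0, p 1)))) w') : ℝ≥0) : ℝ))) = 1 → ω p = 1)
    (hωQ : ∀ p : Fin 3 → v.adicCompletion ↥(maximalRealSubfield L),
      1 < (∏ w' : PlacesOver L v, max 1 (max ((normAbs (w'.1.adicCompletion L) (quadraticLocalEquiv L v (IsCMField.complexConj L) hcδ hδ (p 0, p 1) w') : ℝ≥0) : ℝ)
          ((normAbs (w'.1.adicCompletion L) ((toLocalRing L v (p 2) * algebraMap L (LocalRing L v) δ -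
            toLocalRing L v 2⁻¹ * (quadraticLocalEquiv L v (IsCMField.complexConj L) hcδ hδ (p 0, p 1) *
              conjLocal L (IsCMField.complexConj L) v (quadraticLocalEquiv L v (IsCMField.complexConj L) hcδ hδ (p 0, p 1)))) w') : ℝ≥0) : ℝ))) →
      ω p = ((φ.localComponent w.1 (α p) : ℂˣ) : ℂ))
    {z : ℂ} (hz : 1 < z.re) :
    ((Measure.pi fun _ : Fin 3 => ν) (integralBox ↥(maximalRealSubfield L) (Fin 3) v)).toReal⁻¹ •
        ∫ p : Fin 3 → v.adicCompletion ↥(maximalRealSubfield L),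
          ω p * (((∏ w' : PlacesOver L v, max 1 (max ((normAbs (w'.1.adicCompletion L) (quadraticLocalEquiv L v (IsCMField.complexConj L) hcδ hδ (p 0, p 1) w') : ℝ≥0) : ℝ)
            ((normAbs (w'.1.adicCompletion L) ((toLocalRing L v (p 2) * algebraMap L (LocalRing L v) δ -
              toLocalRing L v 2⁻¹ * (quadraticLocalEquiv L v (IsCMField.complexConj L) hcδ hδ (p 0, p 1) *
                conjLocal L (IsCMField.complexConj L) v (quadraticLocalEquiv L v (IsCMField.complexConj L) hcδ hδ (p 0, p 1)))) w') : ℝ≥0) : ℝ))) : ℝ) : ℂ) ^ (-z)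
          ∂(Measure.pi fun _ : Fin 3 => ν) =
      (1 - φ.valueAtUniformizer w.1 * (v.residueCard : ℂ) ^ (-(2 * z))) * (1 + φ.valueAtUniformizer w.1 * (v.residueCard : ℂ) ^ (-(2 * z - 1))) /
        ((1 - φ.valueAtUniformizer w.1 * (v.residueCard : ℂ) ^ (-(2 * z - 2))) * (1 + φ.valueAtUniformizer w.1 * (v.residueCard : ℂ) ^ (-(2 * z - 2)))) :=
  chiLocalMean_eq_inertToken_of_torusEntry' L hcδ hδ hd v ν hunr w hw h2 hδu (φ.localComponent w.1) (localComponent_eq_one_of_normAbs_eq_one w.1 hφw)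
    (HeckeCharacter.uniformizer L w.1) (normAbs_heckeUniformizer L w.1) rfl (HeckeCharacter.norm_valueAtUniformizer_of_isUnitary hφ w.1) α hα ω hω1 hωQ hz

/-! ## §2 SPLIT: the `χ`-local mean from the torus-entry letters in Gindikin–Karpelevich base coordinates (★ split sequel ∘ ★ (W) §3) -/

/-- **The split token is symmetric in `e₁ ↔ e₂`** (so a supplier may attach either root character to either height). [folklore] -/
theorem splitToken_symm (e₁ e₂ X Y U V : ℂ) :
    (1 - e₁ * X) * (1 - e₂ * X) * (1 - e₁ * e₂ * Y) / ((1 - e₁ * U) * (1 - e₂ * U) * (1 - e₁ * e₂ * V)) =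
      (1 - e₂ * X) * (1 - e₁ * X) * (1 - e₂ * e₁ * Y) / ((1 - e₂ * U) * (1 - e₁ * U) * (1 - e₂ * e₁ * V)) := by
  have h1 : (1 - e₁ * X) * (1 - e₂ * X) * (1 - e₁ * e₂ * Y) = (1 - e₂ * X) * (1 - e₁ * X) * (1 - e₂ * e₁ * Y) := by ring
  have h2 : (1 - e₁ * U) * (1 - e₂ * U) * (1 - e₁ * e₂ * V) = (1 - e₂ * U) * (1 - e₁ * U) * (1 - e₂ * e₁ * V) := by ring
  rw [h1, h2]

include hd in
/-- **THE SPLIT `χ`-LOCAL MEAN FROM THE TORUS-ENTRY LETTERS** — the body of ★ (a-1)'s letter `hsp` at the place `v`, token for token, GIVEN the identifications `(χ_j π : ℂ) = e_j`.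
`v` a place of `L⁺` SPLIT in `L` (`c • w ≠ w`), `|2|_v = 1`, `δ_w` a unit, Haar `ν` on `F := L⁺_v`; in the Gindikin–Karpelevich base coordinates of ★ `K2E1IntertwiningLocalMeanSplitU3`
(`x = p₀ + δ_w p₁`, `y = −(p₀ − δ_w p₁)`, `z = δ_w p₂ − ½(p₀+δ_w p₁)(p₀−δ_w p₁)`, `δ_w =` ★ `splitSqrt`, heights `A = max(1,|x|,|z|)`, `B = max(1,|y|,|z−xy|)`, `Q_v = A·B` ★
`prod_placesOver_max_one_norm_height_eq_gl3_of_split`): unramified characters `χ₁, χ₂` of `F^×`, a uniformizer `π` (`‖π‖ = q_v⁻¹`), unit complex numbers `e_j = χ_j(π)`, torus-entry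
functions `α₁, α₂` with `‖α₁‖·A = 1` on `{A > 1}`, `‖α₂‖·B = 1` on `{B > 1}` ((α): `|t₃| = A⁻¹`, `|t₂t₃| = B⁻¹` in the `GL₃` Iwasawa decomposition of `w₀·n(x,y,z)`), and the weight factored
`ω = c₁·c₂` with `c_j = 1` on the unit shell and `χ_j(α_j)` off it ((c)).  THEN for `1 < Re z`:
`ν(𝒪_v³)⁻¹ • ∫ ω·Q_v^{−z} dν³ = (1 − e₁q_v^{−z})(1 − e₂q_v^{−z})(1 − e₁e₂q_v^{−(2z−1)}) ∕ ((1 − e₁q_v^{−(z−1)})(1 − e₂q_v^{−(z−1)})(1 − e₁e₂q_v^{−(2z−2)}))` — ★ (W) §3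
`shell_split_of_torusEntries` feeds ★ `chiLocalIntegral_eq_token_of_shell_split`; `(ν⊗ν⊗ν)(𝒪_v³) = ν(𝒪_v)³` ★ `pi_integralBox_toReal`, `q_F = q_v` ★ `residueFieldCard_adicCompletion_eq`.
For (a-1)'s `hsp` read `e₁ = φ.valueAtUniformizer w`, `e₂ = φ.valueAtUniformizer w̄` (or swapped, `splitToken_symm`); §0 discharges the identifications for the plain transports `φ_{w'} ∘ ι_{w'}`.
[cite: Rogawski1990, §13.9 p. 229] [cite: Casselman1980, §3] [cite: Langlands1971, §3] [cite: MoeglinWaldspurger1995, IV.1.11] -/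
theorem chiLocalMean_eq_splitToken_of_torusEntries (w : PlacesOver L v) (hw : IsCMField.complexConj L • w.1 ≠ w.1)
    (h2 : Valued.v (2 : v.adicCompletion ↥(maximalRealSubfield L)) = 1) (hδu : Valued.v (algebraMap L (LocalRing L v) δ w) = 1)
    (χ₁ χ₂ : (v.adicCompletion ↥(maximalRealSubfield L))ˣ →* ℂˣ)
    (hχ₁ : ∀ u : (v.adicCompletion ↥(maximalRealSubfield L))ˣ, normAbs (v.adicCompletion ↥(maximalRealSubfield L)) (u : v.adicCompletion ↥(maximalRealSubfield L)) = 1 → χ₁ u = 1)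
    (hχ₂ : ∀ u : (v.adicCompletion ↥(maximalRealSubfield L))ˣ, normAbs (v.adicCompletion ↥(maximalRealSubfield L)) (u : v.adicCompletion ↥(maximalRealSubfield L)) = 1 → χ₂ u = 1)
    (π : (v.adicCompletion ↥(maximalRealSubfield L))ˣ) (hπ : normAbs (v.adicCompletion ↥(maximalRealSubfield L)) (π : v.adicCompletion ↥(maximalRealSubfield L)) = (residueFieldCard (v.adicCompletion ↥(maximalRealSubfield L)) : ℝ≥0)⁻¹)
    {e₁ e₂ : ℂ} (he₁ : ((χ₁ π : ℂˣ) : ℂ) = e₁) (he₂ : ((χ₂ π : ℂˣ) : ℂ) = e₂) (hu₁ : ‖e₁‖ = 1) (hu₂ : ‖e₂‖ = 1)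
    (α₁ α₂ : (Fin 3 → v.adicCompletion ↥(maximalRealSubfield L)) → (v.adicCompletion ↥(maximalRealSubfield L))ˣ)
    (hα₁ : ∀ p : Fin 3 → v.adicCompletion ↥(maximalRealSubfield L), 1 < max 1 (max ((normAbs (v.adicCompletion ↥(maximalRealSubfield L)) (p 0 + splitSqrt ↥(maximalRealSubfield L) L (IsCMField.complexConj L) hcδ hδ v w * p 1) : ℝ≥0) : ℝ)
          ((normAbs (v.adicCompletion ↥(maximalRealSubfield L)) (splitSqrt ↥(maximalRealSubfield L) L (IsCMField.complexConj L) hcδ hδ v w * p 2 - 2⁻¹ * (p 0 + splitSqrt ↥(maximalRealSubfield L) L (IsCMField.complexConj L) hcδ hδ v w * p 1) * (p 0 - splitSqrt ↥(maximalRealSubfield L) L (IsCMField.complexConj L) hcδ hδ v w * p 1)) : ℝ≥0) : ℝ)) →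
      ((normAbs (v.adicCompletion ↥(maximalRealSubfield L)) (α₁ p : v.adicCompletion ↥(maximalRealSubfield L)) : ℝ≥0) : ℝ) * max 1 (max ((normAbs (v.adicCompletion ↥(maximalRealSubfield L)) (p 0 + splitSqrt ↥(maximalRealSubfield L) L (IsCMField.complexConj L) hcδ hδ v w * p 1) : ℝ≥0) : ℝ)
          ((normAbs (v.adicCompletion ↥(maximalRealSubfield L)) (splitSqrt ↥(maximalRealSubfield L) L (IsCMField.complexConj L) hcδ hδ v w * p 2 - 2⁻¹ * (p 0 + splitSqrt ↥(maximalRealSubfield L) L (IsCMField.complexConj L) hcδ hδ v w * p 1) * (p 0 - splitSqrt ↥(maximalRealSubfield L) L (IsCMField.complexConj L) hcδ hδ v w * p 1)) : ℝ≥0) : ℝ)) = 1)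
    (hα₂ : ∀ p : Fin 3 → v.adicCompletion ↥(maximalRealSubfield L), 1 < max 1 (max ((normAbs (v.adicCompletion ↥(maximalRealSubfield L)) (-(p 0 - splitSqrt ↥(maximalRealSubfield L) L (IsCMField.complexConj L) hcδ hδ v w * p 1)) : ℝ≥0) : ℝ)
          ((normAbs (v.adicCompletion ↥(maximalRealSubfield L)) (splitSqrt ↥(maximalRealSubfield L) L (IsCMField.complexConj L) hcδ hδ v w * p 2 - 2⁻¹ * (p 0 + splitSqrt ↥(maximalRealSubfield L) L (IsCMField.complexConj L) hcδ hδ v w * p 1) * (p 0 - splitSqrt ↥(maximalRealSubfield L) L (IsCMField.complexConj L) hcδ hδ v w * p 1) -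
            (p 0 + splitSqrt ↥(maximalRealSubfield L) L (IsCMField.complexConj L) hcδ hδ v w * p 1) * (-(p 0 - splitSqrt ↥(maximalRealSubfield L) L (IsCMField.complexConj L) hcδ hδ v w * p 1))) : ℝ≥0) : ℝ)) →
      ((normAbs (v.adicCompletion ↥(maximalRealSubfield L)) (α₂ p : v.adicCompletion ↥(maximalRealSubfield L)) : ℝ≥0) : ℝ) * max 1 (max ((normAbs (v.adicCompletion ↥(maximalRealSubfield L)) (-(p 0 - splitSqrt ↥(maximalRealSubfield L) L (IsCMField.complexConj L) hcδ hδ v w * p 1)) : ℝ≥0) : ℝ)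
          ((normAbs (v.adicCompletion ↥(maximalRealSubfield L)) (splitSqrt ↥(maximalRealSubfield L) L (IsCMField.complexConj L) hcδ hδ v w * p 2 - 2⁻¹ * (p 0 + splitSqrt ↥(maximalRealSubfield L) L (IsCMField.complexConj L) hcδ hδ v w * p 1) * (p 0 - splitSqrt ↥(maximalRealSubfield L) L (IsCMField.complexConj L) hcδ hδ v w * p 1) -
            (p 0 + splitSqrt ↥(maximalRealSubfield L) L (IsCMField.complexConj L) hcδ hδ v w * p 1) * (-(p 0 - splitSqrt ↥(maximalRealSubfield L) L (IsCMField.complexConj L) hcδ hδ v w * p 1))) : ℝ≥0) : ℝ)) = 1)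
    (c₁ c₂ ω : (Fin 3 → v.adicCompletion ↥(maximalRealSubfield L)) → ℂ)
    (hc₁1 : ∀ p : Fin 3 → v.adicCompletion ↥(maximalRealSubfield L), max 1 (max ((normAbs (v.adicCompletion ↥(maximalRealSubfield L)) (p 0 + splitSqrt ↥(maximalRealSubfield L) L (IsCMField.complexConj L) hcδ hδ v w * p 1) : ℝ≥0) : ℝ)
          ((normAbs (v.adicCompletion ↥(maximalRealSubfield L)) (splitSqrt ↥(maximalRealSubfield L) L (IsCMField.complexConj L) hcδ hδ v w * p 2 - 2⁻¹ * (p 0 + splitSqrt ↥(maximalRealSubfield L) L (IsCMField.complexConj L) hcδ hδ v w * p 1) * (p 0 - splitSqrt ↥(maximalRealSubfield L) L (IsCMField.complexConj L) hcδ hδ v w * p 1)) : ℝ≥0) : ℝ)) = 1 → c₁ p = 1)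
    (hc₁A : ∀ p : Fin 3 → v.adicCompletion ↥(maximalRealSubfield L), 1 < max 1 (max ((normAbs (v.adicCompletion ↥(maximalRealSubfield L)) (p 0 + splitSqrt ↥(maximalRealSubfield L) L (IsCMField.complexConj L) hcδ hδ v w * p 1) : ℝ≥0) : ℝ)
          ((normAbs (v.adicCompletion ↥(maximalRealSubfield L)) (splitSqrt ↥(maximalRealSubfield L) L (IsCMField.complexConj L) hcδ hδ v w * p 2 - 2⁻¹ * (p 0 + splitSqrt ↥(maximalRealSubfield L) L (IsCMField.complexConj L) hcδ hδ v w * p 1) * (p 0 - splitSqrt ↥(maximalRealSubfield L) L (IsCMField.complexConj L) hcδ hδ v w * p 1)) : ℝ≥0) : ℝ)) →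
      c₁ p = ((χ₁ (α₁ p) : ℂˣ) : ℂ))
    (hc₂1 : ∀ p : Fin 3 → v.adicCompletion ↥(maximalRealSubfield L), max 1 (max ((normAbs (v.adicCompletion ↥(maximalRealSubfield L)) (-(p 0 - splitSqrt ↥(maximalRealSubfield L) L (IsCMField.complexConj L) hcδ hδ v w * p 1)) : ℝ≥0) : ℝ)
          ((normAbs (v.adicCompletion ↥(maximalRealSubfield L)) (splitSqrt ↥(maximalRealSubfield L) L (IsCMField.complexConj L) hcδ hδ v w * p 2 - 2⁻¹ * (p 0 + splitSqrt ↥(maximalRealSubfield L) L (IsCMField.complexConj L) hcδ hδ v w * p 1) * (p 0 - splitSqrt ↥(maximalRealSubfield L) L (IsCMField.complexConj L) hcδ hδ v w * p 1) -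
            (p 0 + splitSqrt ↥(maximalRealSubfield L) L (IsCMField.complexConj L) hcδ hδ v w * p 1) * (-(p 0 - splitSqrt ↥(maximalRealSubfield L) L (IsCMField.complexConj L) hcδ hδ v w * p 1))) : ℝ≥0) : ℝ)) = 1 → c₂ p = 1)
    (hc₂B : ∀ p : Fin 3 → v.adicCompletion ↥(maximalRealSubfield L), 1 < max 1 (max ((normAbs (v.adicCompletion ↥(maximalRealSubfield L)) (-(p 0 - splitSqrt ↥(maximalRealSubfield L) L (IsCMField.complexConj L) hcδ hδ v w * p 1)) : ℝ≥0) : ℝ)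
          ((normAbs (v.adicCompletion ↥(maximalRealSubfield L)) (splitSqrt ↥(maximalRealSubfield L) L (IsCMField.complexConj L) hcδ hδ v w * p 2 - 2⁻¹ * (p 0 + splitSqrt ↥(maximalRealSubfield L) L (IsCMField.complexConj L) hcδ hδ v w * p 1) * (p 0 - splitSqrt ↥(maximalRealSubfield L) L (IsCMField.complexConj L) hcδ hδ v w * p 1) -
            (p 0 + splitSqrt ↥(maximalRealSubfield L) L (IsCMField.complexConj L) hcδ hδ v w * p 1) * (-(p 0 - splitSqrt ↥(maximalRealSubfield L) L (IsCMField.complexConj L) hcδ hδ v w * p 1))) : ℝ≥0) : ℝ)) →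
      c₂ p = ((χ₂ (α₂ p) : ℂˣ) : ℂ))
    (hω : ∀ p : Fin 3 → v.adicCompletion ↥(maximalRealSubfield L), ω p = c₁ p * c₂ p)
    {z : ℂ} (hz : 1 < z.re) :
    ((Measure.pi fun _ : Fin 3 => ν) (integralBox ↥(maximalRealSubfield L) (Fin 3) v)).toReal⁻¹ •
        ∫ p : Fin 3 → v.adicCompletion ↥(maximalRealSubfield L),
          ω p * (((∏ w' : PlacesOver L v, max 1 (max ((normAbs (w'.1.adicCompletion L) (quadraticLocalEquiv L v (IsCMField.complexConj L) hcδ hδ (p 0, p 1) w') : ℝ≥0) : ℝ)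
            ((normAbs (w'.1.adicCompletion L) ((toLocalRing L v (p 2) * algebraMap L (LocalRing L v) δ -
              toLocalRing L v 2⁻¹ * (quadraticLocalEquiv L v (IsCMField.complexConj L) hcδ hδ (p 0, p 1) *
                conjLocal L (IsCMField.complexConj L) v (quadraticLocalEquiv L v (IsCMField.complexConj L) hcδ hδ (p 0, p 1)))) w') : ℝ≥0) : ℝ))) : ℝ) : ℂ) ^ (-z)
          ∂(Measure.pi fun _ : Fin 3 => ν) =
      (1 - e₁ * (v.residueCard : ℂ) ^ (-z)) * (1 - e₂ * (v.residueCard : ℂ) ^ (-z)) *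
          (1 - e₁ * e₂ * (v.residueCard : ℂ) ^ (-(2 * z - 1))) /
        ((1 - e₁ * (v.residueCard : ℂ) ^ (-(z - 1))) * (1 - e₂ * (v.residueCard : ℂ) ^ (-(z - 1))) *
          (1 - e₁ * e₂ * (v.residueCard : ℂ) ^ (-(2 * z - 2)))) := by
  haveI : Algebra.IsQuadraticExtension ↥(maximalRealSubfield L) L := IsCMField.isQuadraticExtension L
  -- `δ_w` and `2` are `v`-adic units
  have hval : Valued.v (splitSqrt ↥(maximalRealSubfield L) L (IsCMField.complexConj L) hcδ hδ v w) = 1 := by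
    rw [← valued_toPlace_of_split ↥(maximalRealSubfield L) L (IsCMField.complexConj L) v w hw (splitSqrt ↥(maximalRealSubfield L) L (IsCMField.complexConj L) hcδ hδ v w),
      toPlace_splitSqrt ↥(maximalRealSubfield L) L (IsCMField.complexConj L) hcδ hδ hd v w hw]
    exact hδu
  have hδ1 : normAbs (v.adicCompletion ↥(maximalRealSubfield L)) (splitSqrt ↥(maximalRealSubfield L) L (IsCMField.complexConj L) hcδ hδ v w) = 1 := normAbs_eq_one_of_valued_eq_one v hval
  have h2' : normAbs (v.adicCompletion ↥(maximalRealSubfield L)) (2 : v.adicCompletion ↥(maximalRealSubfield L)) = 1 := normAbs_eq_one_of_valued_eq_one v h2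
  -- ★ (W) §3: the split shell letter, with the tokens renamed `e₁, e₂`
  have hshell := shell_split_of_torusEntries (splitSqrt ↥(maximalRealSubfield L) L (IsCMField.complexConj L) hcδ hδ v w) χ₁ χ₂ hχ₁ hχ₂ π hπ α₁ α₂ hα₁ hα₂ c₁ c₂ ω hc₁1 hc₁A hc₂1 hc₂B hω
  simp only [he₁, he₂] at hshell
  -- ★ split sequel: the weighted two-exponent Gindikin–Karpelevich cell
  have hI := chiLocalIntegral_eq_token_of_shell_split ν hδ1 h2' hu₁ hu₂ ω hshell hz
  -- pointwise bridge `Q_v^{−z} = A^{−z}·B^{−z}` (★ `prod_placesOver_max_one_norm_height_eq_gl3_of_split`)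
  have hpt : ∀ p : Fin 3 → v.adicCompletion ↥(maximalRealSubfield L),
      ω p * (((∏ w' : PlacesOver L v, max 1 (max ((normAbs (w'.1.adicCompletion L) (quadraticLocalEquiv L v (IsCMField.complexConj L) hcδ hδ (p 0, p 1) w') : ℝ≥0) : ℝ)
            ((normAbs (w'.1.adicCompletion L) ((toLocalRing L v (p 2) * algebraMap L (LocalRing L v) δ -
              toLocalRing L v 2⁻¹ * (quadraticLocalEquiv L v (IsCMField.complexConj L) hcδ hδ (p 0, p 1) *
                conjLocal L (IsCMField.complexConj L) v (quadraticLocalEquiv L v (IsCMField.complexConj L) hcδ hδ (p 0, p 1)))) w') : ℝ≥0) : ℝ))) : ℝ) : ℂ) ^ (-z) =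
        ω p * ((((max 1 (max ((normAbs (v.adicCompletion ↥(maximalRealSubfield L)) (p 0 + splitSqrt ↥(maximalRealSubfield L) L (IsCMField.complexConj L) hcδ hδ v w * p 1) : ℝ≥0) : ℝ)
          ((normAbs (v.adicCompletion ↥(maximalRealSubfield L)) (splitSqrt ↥(maximalRealSubfield L) L (IsCMField.complexConj L) hcδ hδ v w * p 2 - 2⁻¹ * (p 0 + splitSqrt ↥(maximalRealSubfield L) L (IsCMField.complexConj L) hcδ hδ v w * p 1) * (p 0 - splitSqrt ↥(maximalRealSubfield L) L (IsCMField.complexConj L) hcδ hδ v w * p 1)) : ℝ≥0) : ℝ))) : ℝ) : ℂ) ^ (-z) *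
          (((max 1 (max ((normAbs (v.adicCompletion ↥(maximalRealSubfield L)) (-(p 0 - splitSqrt ↥(maximalRealSubfield L) L (IsCMField.complexConj L) hcδ hδ v w * p 1)) : ℝ≥0) : ℝ)
          ((normAbs (v.adicCompletion ↥(maximalRealSubfield L)) (splitSqrt ↥(maximalRealSubfield L) L (IsCMField.complexConj L) hcδ hδ v w * p 2 - 2⁻¹ * (p 0 + splitSqrt ↥(maximalRealSubfield L) L (IsCMField.complexConj L) hcδ hδ v w * p 1) * (p 0 - splitSqrt ↥(maximalRealSubfield L) L (IsCMField.complexConj L) hcδ hδ v w * p 1) -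
            (p 0 + splitSqrt ↥(maximalRealSubfield L) L (IsCMField.complexConj L) hcδ hδ v w * p 1) * (-(p 0 - splitSqrt ↥(maximalRealSubfield L) L (IsCMField.complexConj L) hcδ hδ v w * p 1))) : ℝ≥0) : ℝ))) : ℝ) : ℂ) ^ (-z)) := fun p => by
    rw [prod_placesOver_max_one_norm_height_eq_gl3_of_split L (IsCMField.complexConj L) hcδ hδ hd v w hw (p 0) (p 1) (p 2), Complex.ofReal_mul,
      Complex.mul_cpow_ofReal_nonneg (le_trans zero_le_one (le_max_left _ _)) (le_trans zero_le_one (le_max_left _ _))]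
  rw [integral_congr_ae (Eventually.of_forall hpt), hI, pi_integralBox_toReal L v ν, residueFieldCard_adicCompletion_eq, Complex.real_smul]
  have hν : ((ν.real (primePowBall (v.adicCompletion ↥(maximalRealSubfield L)) 0) : ℝ) : ℂ) ≠ 0 :=
    Complex.ofReal_ne_zero.2 (LocalFieldHaar.measureReal_primePowBall_pos ν 0).ne'
  rw [Complex.ofReal_inv, Complex.ofReal_pow, ← mul_assoc, inv_mul_cancel₀ (pow_ne_zero 3 hν), one_mul]

end Summit.HodgeConjecture.HodgeConjecture.Cruxes.H413.K2E1ChiLocalMeansOfShellU3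

end
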